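import Mathlib
import HarnessLib.Audit
import Summits.PneNP.PneNP.Theorems.PstarQuadRank

/-!
# Rank rigidity III: rank-two forms without a translation direction — the OR-set and the NOR flat (ROUND-24, memo §10 R7 rows (ii)/(iii))

FRONTIER range-avoidance ladder, rung F-N3, ROUND 24 (cell `pnp-ideate`, planner memo `r24/CORE-BOUND-NOTES.md` §10 R7; restricted-model
proof complexity — nothing here bears on `P` versus `NP`).  Sequel of `PstarRankRigidity` / `PstarRankRigidityTwo`.

A quadratic `q` on a finite `𝔽₂`-module whose polar form `B` has RANK TWO (`B a b = 1`, `dim rad B + 2 ≥ dim M`) and which has NO translation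
direction (`q` is constant on `rad B`) is, coordinate-free,

  `q x = (B x b + C)·(B x a + A) + κ`      (`quad_eq_of_rank_two`; `rank_two_structure`: `B x y = B x b · B y a + B y b · B x a`),

so either `κ = 0` — `Z(q)` is the OR-set `{μ₁ μ₂ = 0}` and a quadratic `g` vanishing on it is `0` or `q` — or `κ = 1` — `Z(q)` is the
codimension-two FLAT `{μ₁ = μ₂ = 1}` (the NOR row of the R7 table) and `g = (μ₁+1)·m₁ + (μ₂+1)·m₂` with `m₁, m₂` affine
(`PstarCubeIdeals.exists_const_of_orSet` / `exists_affine_of_codimTwo` with the dual directions `a, b`): `classification_rank_two`.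
Also `bias_sq_eq_of_invariant`: without a translation direction `bias(q)² = 2^{dim M + dim rad B}` EXACTLY (the equality case of
`PstarQuadBias.bias_sq_le`), and `bias_eq_zero_of_translation`: with one, `bias q = 0` — so "translation direction" is exactly "balanced".
-/

set_option linter.dupNamespace false -- `Summit.PneNP.PneNP.…`: summit = sub-problem name (D-0017 single-conjunct layout)

open Finset Module
open Summit.PneNP.PneNP.Theorems.PstarQuadBias (chi chi_zero chi_add sum_chi_eq_zero_of_shift sum_chi_bilin_of_forall sum_chi_bilin_of_exists
  card_eq_two_pow_finrank)
open Summit.PneNP.PneNP.Theorems.PstarCubeIdeals (IsAffineFn IsQuadFn exists_const_of_orSet exists_affine_of_codimTwo)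
open Summit.PneNP.PneNP.Theorems.PstarQuadRank

namespace Summit.PneNP.PneNP.Theorems.PstarRankRigidityThree

/-- Every element of `𝔽₂` is `0` or `1`. -/
private theorem zmod2_cases (t : ZMod 2) : t = 0 ∨ t = 1 := by
  revert t; decide

/-- In `𝔽₂`, `x + x = 0`. -/
private theorem zmod2_add_self (x : ZMod 2) : x + x = 0 := by
  revert x; decide

variable {M : Type*} [AddCommGroup M] [Module (ZMod 2) M]

/-- In an `𝔽₂`-module, `u + u = 0`. -/
private theorem add_self_eq_zero (u : M) : u + u = 0 := by
  rw [← two_smul (ZMod 2) u, show (2 : ZMod 2) = 0 from rfl, zero_smul]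

/-! ## Translation directions and the bias -/

/-- A function constant on the radical of its polar form is invariant under the radical. -/
theorem invariant_of_const_on_rad {q : M → ZMod 2} {B : LinearMap.BilinForm (ZMod 2) M}
    (hB : ∀ x w, q (x + w) = q x + q w + q 0 + B x w) (hinv : ∀ r ∈ rad B, q r = q 0) {r : M}
    (hr : r ∈ rad B) (x : M) : q (x + r) = q x := by
  rw [hB, hinv r hr, polar_symm hB, mem_rad.1 hr x]
  have := zmod2_add_self (q 0); linear_combination this

section Bias

variable [Fintype M] [DecidableEq M] {q : M → ZMod 2} {B : LinearMap.BilinForm (ZMod 2) M}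

omit [DecidableEq M] in
/-- With a translation direction the function is balanced. -/
theorem bias_eq_zero_of_translation {r : M} (hr : ∀ x, q (x + r) = q x + 1) : bias q = 0 := by
  classical
  unfold bias
  exact sum_chi_eq_zero_of_shift univ r (fun _ _ => mem_univ _) q fun x _ => hr x

/-- **Without a translation direction `bias(q)² = 2^{dim M + dim rad B}` exactly** (the equality case of `PstarQuadBias.bias_sq_le`). -/
theorem bias_sq_eq_of_invariant (hB : ∀ x w, q (x + w) = q x + q w + q 0 + B x w) (hinv : ∀ r ∈ rad B, q r = q 0) :
    bias q ^ 2 = 2 ^ (finrank (ZMod 2) M + finrank (ZMod 2) (rad B)) := by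
  classical
  set ℛ : Finset M := univ.filter fun x => x ∈ rad B with hℛdef
  have hℛ : ∀ x, x ∈ ℛ ↔ ∀ n, B n x = 0 := by
    intro x; rw [hℛdef, mem_filter, mem_rad]
    simp only [mem_univ, true_and]
    exact ⟨fun h n => by rw [polar_symm hB]; exact h n, fun h y => by rw [polar_symm hB]; exact h y⟩
  have hℛcard : (ℛ.card : ℤ) = 2 ^ finrank (ZMod 2) (rad B) := by
    exact_mod_cast card_eq_two_pow_finrank (rad B) ℛ (fun x => by rw [hℛdef, mem_filter]; simp)
  -- `q x + q (x + w) = (q w + q 0) + B x w`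
  have key : ∀ x w, q x + q (x + w) = (q w + q 0) + B x w := by
    intro x w; rw [hB]; have := zmod2_add_self (q x); linear_combination this
  -- the square as a double sum, inner sum reindexed by `w := x + x'`
  have h1 : bias q ^ 2 = ∑ x, ∑ w, chi (q w + q 0) * chi (B x w) := by
    unfold bias
    rw [sq, sum_mul_sum]
    refine sum_congr rfl fun x _ => ?_
    have hinv2 : ∀ w ∈ (univ : Finset M), x + (x + w) = w := fun w _ => by rw [← add_assoc, add_self_eq_zero, zero_add]
    rw [← sum_nbij' (fun w => x + w) (fun w => x + w) (fun _ _ => mem_univ _) (fun _ _ => mem_univ _) hinv2 hinv2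
      (fun w _ => (rfl : chi (q x) * chi (q (x + w)) = _))]
    refine sum_congr rfl fun w _ => ?_
    rw [← chi_add, ← chi_add, key]
  -- swap and evaluate the inner character sum: `|M|` on the radical, `0` off it
  have h2 : ∑ x, ∑ w, chi (q w + q 0) * chi (B x w) = ∑ w, (if w ∈ ℛ then (Fintype.card M : ℤ) * chi (q w + q 0) else 0) := by
    rw [sum_comm]
    refine sum_congr rfl fun w _ => ?_
    rw [← mul_sum]
    by_cases hw : w ∈ ℛ
    · rw [if_pos hw, sum_chi_bilin_of_forall B ⊤ univ (fun x => by simp) (fun n _ => (hℛ w).1 hw n), Finset.card_univ]; ring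
    · have hex : ∃ n ∈ (⊤ : Submodule (ZMod 2) M), B n w ≠ 0 := by
        by_contra hne; push Not at hne; exact hw ((hℛ w).2 fun n => hne n trivial)
      rw [if_neg hw, sum_chi_bilin_of_exists B ⊤ univ (fun x => by simp) hex]; ring
  -- on the radical every term is `χ(0) = 1`
  have h3 : ∑ w, (if w ∈ ℛ then (Fintype.card M : ℤ) * chi (q w + q 0) else 0) = (Fintype.card M : ℤ) * ℛ.card := by
    rw [← sum_filter, show (univ.filter fun w => w ∈ ℛ) = ℛ from by ext w; simp]
    rw [show (ℛ.card : ℤ) = ∑ _w ∈ ℛ, (1 : ℤ) by simp, mul_sum]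
    refine sum_congr rfl fun w hw => ?_
    have hwr : w ∈ rad B := by rw [hℛdef, mem_filter] at hw; exact hw.2
    rw [hinv w hwr, zmod2_add_self, chi_zero, mul_one]
  rw [h1, h2, h3, card_eq_pow, hℛcard, ← pow_add]

end Bias

/-! ## The structure of rank-two forms -/

section RankTwo

variable [FiniteDimensional (ZMod 2) M] {q : M → ZMod 2} {B : LinearMap.BilinForm (ZMod 2) M}

/-- **Rank-two structure.**  An alternating symmetric form with `B a b = 1` and radical of codimension `≤ 2` is
`B x y = B x b · B y a + B y b · B x a`. -/
theorem rank_two_structure (halt : ∀ x, B x x = 0) (hsymm : ∀ x y, B x y = B y x) {a b : M} (hab : B a b = 1)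
    (hrank : finrank (ZMod 2) M ≤ finrank (ZMod 2) (rad B) + 2) (x y : M) :
    B x y = B x b * B y a + B y b * B x a := by
  have hba : B b a = 1 := by rw [hsymm]; exact hab
  -- `K := ker B(·,b) ⊓ ker B(·,a)` has codimension exactly `2` and contains the radical, hence equals it
  let u : M →ₗ[ZMod 2] ZMod 2 := B.flip b
  let ℓ : M →ₗ[ZMod 2] ZMod 2 := B.flip a
  have hu : ∀ z, u z = B z b := fun z => LinearMap.flip_apply _ _ _
  have hℓ : ∀ z, ℓ z = B z a := fun z => LinearMap.flip_apply _ _ _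
  have hradK : rad B ≤ LinearMap.ker u ⊓ LinearMap.ker ℓ := by
    intro z hz
    rw [Submodule.mem_inf, LinearMap.mem_ker, LinearMap.mem_ker, hu, hℓ]
    exact ⟨mem_rad.1 hz b, mem_rad.1 hz a⟩
  have lt1 : LinearMap.ker u ⊓ LinearMap.ker ℓ < LinearMap.ker u := by
    refine lt_of_le_of_ne inf_le_left fun h => ?_
    have hb : b ∈ LinearMap.ker u := by rw [LinearMap.mem_ker, hu, halt]
    rw [← h, Submodule.mem_inf, LinearMap.mem_ker, LinearMap.mem_ker, hℓ, hba] at hb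
    exact one_ne_zero hb.2
  have lt2 : LinearMap.ker u < ⊤ := by
    refine lt_of_le_of_ne le_top fun h => ?_
    have ha : a ∈ LinearMap.ker u := by rw [h]; trivial
    rw [LinearMap.mem_ker, hu, hab] at ha
    exact one_ne_zero ha
  have d1 := Submodule.finrank_lt_finrank_of_lt lt1
  have d2 := Submodule.finrank_lt_finrank_of_lt lt2
  rw [finrank_top] at d2
  have hKrad : LinearMap.ker u ⊓ LinearMap.ker ℓ = rad B :=
    (Submodule.eq_of_le_of_finrank_le hradK (by omega)).symm
  -- decompose `x = x' + (u x) a + (ℓ x) b` with `x' ∈ rad B`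
  have hx' : x - (u x) • a - (ℓ x) • b ∈ rad B := by
    rw [← hKrad, Submodule.mem_inf, LinearMap.mem_ker, LinearMap.mem_ker]
    simp only [map_sub, map_smul, LinearMap.sub_apply, LinearMap.smul_apply, smul_eq_mul, hu, hℓ, hab, hba, halt a, halt b]
    constructor <;> ring
  have e : B x y = B (x - (u x) • a - (ℓ x) • b) y + u x * B a y + ℓ x * B b y := by
    simp only [map_sub, map_smul, LinearMap.sub_apply, LinearMap.smul_apply, smul_eq_mul]; ring
  rw [e, mem_rad.1 hx' y, zero_add, hu, hℓ, hsymm a y, hsymm b y]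
  ring

/-- **Rank-two quadratics without a translation direction are `μ₁ μ₂ + κ`**: with `B a b = 1`, radical of codimension `≤ 2` and `q` constant on
the radical, `q x = (B x b + C)(B x a + A) + κ` for the constants `A = q a + q 0`, `C = q b + q 0`, `κ = A·C + q 0`. -/
theorem quad_eq_of_rank_two (hB : ∀ x w, q (x + w) = q x + q w + q 0 + B x w) {a b : M} (hab : B a b = 1)
    (hrank : finrank (ZMod 2) M ≤ finrank (ZMod 2) (rad B) + 2) (hinv : ∀ r ∈ rad B, q r = q 0) (x : M) :
    q x = (B x b + (q b + q 0)) * (B x a + (q a + q 0)) + ((q a + q 0) * (q b + q 0) + q 0) := by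
  have halt := polar_self hB
  have hsymm := polar_symm hB
  have hba : B b a = 1 := by rw [hsymm]; exact hab
  have hstr := rank_two_structure halt hsymm hab hrank
  -- the vector `x' = x - (B x b) a - (B x a) b` lies in the radical
  have hx' : x - (B x b) • a - (B x a) • b ∈ rad B := by
    rw [mem_rad]; intro y
    simp only [map_sub, map_smul, LinearMap.sub_apply, LinearMap.smul_apply, smul_eq_mul]
    rw [hstr x y, hsymm a y, hsymm b y]; ring
  -- evaluate `q` at `x = x' + (B x b) a + (B x a) b` using invariance under the radical
  have hdec : x = (x - (B x b) • a - (B x a) • b) + ((B x b) • a + (B x a) • b) := by abel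
  have step : q x = q ((B x b) • a + (B x a) • b) := by
    conv_lhs => rw [hdec, add_comm]
    exact invariant_of_const_on_rad hB hinv hx' _
  rw [step]
  -- the four cases for the two coefficients
  rcases zmod2_cases (B x b) with hu | hu <;> rcases zmod2_cases (B x a) with hl | hl <;> rw [hu, hl]
  · simp only [zero_smul, add_zero]
    generalize q a = QA; generalize q b = QB; generalize q 0 = Q0; revert QA QB Q0; decide
  · rw [zero_smul, one_smul, zero_add]
    generalize q a = QA; generalize q b = QB; generalize q 0 = Q0; revert QA QB Q0; decide
  · rw [one_smul, zero_smul, add_zero]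
    generalize q a = QA; generalize q b = QB; generalize q 0 = Q0; revert QA QB Q0; decide
  · rw [one_smul, one_smul, hB a b, hab]
    generalize q a = QA; generalize q b = QB; generalize q 0 = Q0; revert QA QB Q0; decide

/-- **Classification at rank two without a translation direction.**  Either `q` is the product `μ₁ μ₂` (`Z(q)` an OR-set) and a quadratic `g`
vanishing on `Z(q)` is `0` or `q`; or `q = μ₁ μ₂ + 1` (`Z(q)` the NOR flat `{μ₁ = μ₂ = 1}`) and `g = (μ₁ + 1)·m₁ + (μ₂ + 1)·m₂` with `m₁, m₂`
affine.  Here `μ₁ = B(·) b + q b + q 0`, `μ₂ = B(·) a + q a + q 0`. -/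
theorem classification_rank_two (hB : ∀ x w, q (x + w) = q x + q w + q 0 + B x w) {a b : M} (hab : B a b = 1)
    (hrank : finrank (ZMod 2) M ≤ finrank (ZMod 2) (rad B) + 2) (hinv : ∀ r ∈ rad B, q r = q 0) {g : M → ZMod 2} (hg : IsQuadFn g)
    (hZ : ∀ x, q x = 0 → g x = 0) :
    ((∀ x, q x = (B x b + (q b + q 0)) * (B x a + (q a + q 0))) ∧ ((∀ x, g x = 0) ∨ ∀ x, g x = q x)) ∨
    ((∀ x, q x = (B x b + (q b + q 0)) * (B x a + (q a + q 0)) + 1) ∧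
      ∃ m₁ m₂ : M → ZMod 2, IsAffineFn m₁ ∧ IsAffineFn m₂ ∧
        ∀ x, g x = (B x b + (q b + q 0) + 1) * m₁ x + (B x a + (q a + q 0) + 1) * m₂ x) := by
  have halt := polar_self hB
  have hsymm := polar_symm hB
  have hq := quad_eq_of_rank_two hB hab hrank hinv
  -- dual directions: `a` flips `μ₁ = B(·) b + C` and fixes `μ₂ = B(·) a + A`; `b` the other way round
  have f₁a : ∀ x, B (x + a) b + (q b + q 0) = (B x b + (q b + q 0)) + 1 := by
    intro x; rw [map_add, LinearMap.add_apply, hab]; ring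
  have f₂a : ∀ x, B (x + a) a + (q a + q 0) = B x a + (q a + q 0) := by
    intro x; rw [map_add, LinearMap.add_apply, halt a, add_zero]
  have f₁b : ∀ x, B (x + b) b + (q b + q 0) = B x b + (q b + q 0) := by
    intro x; rw [map_add, LinearMap.add_apply, halt b, add_zero]
  have f₂b : ∀ x, B (x + b) a + (q a + q 0) = (B x a + (q a + q 0)) + 1 := by
    intro x; rw [map_add, LinearMap.add_apply, hsymm b a, hab]; ring
  rcases zmod2_cases ((q a + q 0) * (q b + q 0) + q 0) with hκ | hκ
  · -- OR-set: `q = μ₁ μ₂`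
    left
    have hq0 : ∀ x, q x = (B x b + (q b + q 0)) * (B x a + (q a + q 0)) := fun x => by rw [hq x, hκ, add_zero]
    refine ⟨hq0, ?_⟩
    have hZ' : ∀ x, B x b + (q b + q 0) = 0 ∨ B x a + (q a + q 0) = 0 → g x = 0 := by
      intro x hx; apply hZ; rw [hq0 x]; rcases hx with h | h
      · rw [h, zero_mul]
      · rw [h, mul_zero]
    obtain ⟨κ', hκ'⟩ := exists_const_of_orSet (l₁ := fun x => B x b + (q b + q 0)) (l₂ := fun x => B x a + (q a + q 0))
      (v₁ := a) (v₂ := b) f₁a f₂a f₂b hg hZ'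
    rcases zmod2_cases κ' with h0 | h0
    · left; intro x; rw [hκ' x, h0, zero_mul]
    · right; intro x; rw [hκ' x, h0, one_mul, hq0 x]
  · -- NOR flat: `q = μ₁ μ₂ + 1`
    right
    have hq1 : ∀ x, q x = (B x b + (q b + q 0)) * (B x a + (q a + q 0)) + 1 := fun x => by rw [hq x, hκ]
    refine ⟨hq1, ?_⟩
    -- `Z(q) = {μ₁ + 1 = 0, μ₂ + 1 = 0}`
    have hZ' : ∀ x, B x b + (q b + q 0) + 1 = 0 → B x a + (q a + q 0) + 1 = 0 → g x = 0 := by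
      intro x h1 h2; apply hZ; rw [hq1 x]
      have e1 : B x b + (q b + q 0) = 1 := by
        rcases zmod2_cases (B x b + (q b + q 0)) with e | e
        · rw [e] at h1; exact absurd h1 (by decide)
        · exact e
      have e2 : B x a + (q a + q 0) = 1 := by
        rcases zmod2_cases (B x a + (q a + q 0)) with e | e
        · rw [e] at h2; exact absurd h2 (by decide)
        · exact e
      rw [e1, e2]; decide
    have hl₂ : IsAffineFn (fun x => B x a + (q a + q 0) + 1) := by
      intro x w
      show B (x + w) a + (q a + q 0) + 1 = (B x a + (q a + q 0) + 1) + (B w a + (q a + q 0) + 1) + (B 0 a + (q a + q 0) + 1)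
      rw [map_add, LinearMap.add_apply, LinearMap.map_zero, LinearMap.zero_apply]
      generalize (B x) a = U; generalize (B w) a = U'; generalize q a + q 0 = A
      revert U U' A; decide
    exact exists_affine_of_codimTwo (l₁ := fun x => B x b + (q b + q 0) + 1) (l₂ := fun x => B x a + (q a + q 0) + 1)
      (v₁ := a) (v₂ := b) (fun x => by show B (x + a) b + (q b + q 0) + 1 = _; rw [f₁a])
      (fun x => by show B (x + a) a + (q a + q 0) + 1 = _; rw [f₂a])
      (fun x => by show B (x + b) b + (q b + q 0) + 1 = _; rw [f₁b])
      (fun x => by show B (x + b) a + (q a + q 0) + 1 = _; rw [f₂b]) hg hZ' hl₂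

end RankTwo

end Summit.PneNP.PneNP.Theorems.PstarRankRigidityThree
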